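import Literature.NumberTheory.ComplexMultiplication.MultiFieldWeilPairAdditiveTools
import HarnessLib

/-!
# MULTI-FIELD WEIL ENGINE, census — BLOCK ADDITIVITY WITH JOINTLY-ONTO EXCEPTIONAL SETS: the slot criterion across blocks may fail on any set of slots meeting two blocks
# and pairwise sharing constituents, provided that set is jointly onto in `U(Σ)` (e.g. a nondegenerate sub-family)

Cell `pub-hodgecm2` (COR-CM), seat b30 gen 36 (2026-08-25); count-neutral own lane MULTI-FIELD WEIL ENGINE (stem `MultiFieldWeil*`).  Sequel of
`CorCM/MultiFieldWeilPairAdditiveBlocks.lean` (exceptional PAIRS, isolated from third slots) in the same abstract setting of seat p2's `CMTypeRank*` files; theorems only, no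
definition, no named fact, no `sorry`; nothing Hodge-theoretic is asserted and `HC_CM` is NOT touched.

**THEOREM (`typeRank_sigmaType_add_card_eq_of_jointlyOnto_sets_fiber`).**  `κ : I ↠ C` a partition of the slots.  Suppose that for every finite set `J` of slots MEETING TWO
BLOCKS in which every two distinct slots SHARE a constituent in both orders (p2's «pairwise» predicate fails for every ordered pair of distinct members), the sub-family on `J`
is JOINTLY ONTO: every tuple `(a_i ∈ U(Φ_i))_{i ∈ J}` is the tuple of restrictions of one `m ∈ U(Σ)` (this holds when the sub-family `Σ|_J` is nondegenerate — seat p2's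
`forall_map_slotExt_le_of_typeRank_sigmaType_eq` — e.g. `jointlyOnto_of_typeRank_pair_eq`).  Then `rank(Σ) + |C| = Σ_c rank(Σ|_c) + 1`, i.e. `Hg(∏_i A_i) = ∏_c Hg(∏_{κ i = c} A_i)`.
This contains the pair version (a jointly-onto pair isolated from third slots: every such `J` has two elements) and p2's slot criterion (no such `J`).  USE: up to THREE
non-isogenous simple CM threefolds of one sextic field without imaginary quadratic subfield in different blocks, sisters `k·F ∕ k′·F`, … — any set whose census says
«nondegenerate».

PROOF (p2's orthogonality argument, support version).  `M = U(Σ) ≤ U = ⊕_c U(Σ|_c)`; if `M < U` a minimal non-zero stable `P ≤ U ∩ M^⊥` has each inner slot restriction zero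
or injective; its SUPPORT `J` (the injective slots) consists of slots pairwise sharing the constituent `P`; if `J` meets two blocks, joint surjectivity on `J` gives `m ∈ M`
with the restrictions of a non-zero `f ∈ P` on `J`, whence `0 = ⟨m, f⟩ = Σ_{i ∈ J} |f_i|² > 0`; if `J` lies in one block, `f` is supported on that block and p2's case applies.

[cite: Gordon1999HodgeAVSurvey, §3 Theorem (Imai, Murty) (proof), 7.5–7.7] [cite: MoonenZarhin1999LowDim, §3 (3.1), Remark (3.9)] [cite: Serre1977, §1.3, §2.2 Prop. 4]
[cite: Deligne1982HodgeCycles, I Ex. 3.7 (c)]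

Provenance: Literature home (namespace `Literature.NumberTheory.ComplexMultiplication.MultiFieldWeil`) of the Summits-side `CorCM/MultiFieldWeilJointlyOntoBlocks` (cell `pub-hodgecm2`, COR-CM; all its imports are `Literature/`, Mathlib and the already re-homed `MultiFieldWeilPairAdditiveTools`), which `Literature/` may not import; theorems only, no named fact, no definition. Nothing here bears on `HC_CM`. Lane `lit-hodgefound` (Layer A3: CM types, their Kubota ranks and Galois combinatorics), seat p20.
-/

set_option autoImplicit false

noncomputable section

open scoped BigOperators

namespace Literature.NumberTheory.ComplexMultiplication.MultiFieldWeil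

open Literature.NumberTheory.ComplexMultiplication.PointwiseConjugation

open Literature.NumberTheory.ComplexMultiplication

universe u v w

variable {G : Type w} [Group G] {I : Type u} {E : I → Type v} [∀ i, MulAction G (E i)] {C : Type u}

section Core

variable [Fintype I] [DecidableEq I] [Fintype C] [DecidableEq C] [∀ i, Fintype (E i)]

/-- **THE CORE (support version): `ext_c U(Σ|_c) ≤ U(⊔_c Σ|_c)` when every set of slots meeting two blocks and pairwise sharing constituents is jointly onto in `U(Σ)`.**
[cite: Gordon1999HodgeAVSurvey, §3 Theorem (proof)] [cite: Serre1977, §2.2 Prop. 4 (proof)] -/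
theorem map_slotExt_antiSpan_fiber_le_of_jointlyOnto_sets {Φ : ∀ i, Set (E i)} (κ : I → C)
    (hyp : ∀ J : Finset I, (∃ i ∈ J, ∃ j ∈ J, κ i ≠ κ j) →
      (∀ i ∈ J, ∀ j ∈ J, i ≠ j → ¬ (∀ P : Submodule ℚ (E i → ℚ), P ≤ antiSpan G (Φ i) → (∀ g : G, ∀ f ∈ P, (fun x => f (g • x)) ∈ P) →
          ∀ T : (E i → ℚ) →ₗ[ℚ] (E j → ℚ), (∀ g : G, ∀ f ∈ P, T (fun x => f (g • x)) = fun y => T f (g • y)) →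
            (∀ f ∈ P, T f ∈ antiSpan G (Φ j)) → (∀ f ∈ P, T f = 0 → f = 0) → P = ⊥)) →
      ∀ a : ∀ i, E i → ℚ, (∀ i ∈ J, a i ∈ antiSpan G (Φ i)) →
        ∃ m ∈ antiSpan G (sigmaType Φ), ∀ i ∈ J, LinearMap.funLeft ℚ ℚ (Sigma.mk i) m = a i)
    (c₀ : C) :
    (antiSpan G (sigmaType fun i : {i // κ i = c₀} => Φ i.1)).map (slotExt c₀) ≤
      antiSpan G (sigmaType fun c => sigmaType fun i : {i // κ i = c} => Φ i.1) := by
  classical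
  -- outer slots `E' c = ⊔_{κ i = c} E_i`, outer restrictions `p c`, inner restrictions `q c i`
  set Ψ : ∀ c : C, Set (Σ i : {i // κ i = c}, E i.1) := fun c => sigmaType fun i : {i // κ i = c} => Φ i.1 with hΨ_def
  set p : ∀ c : C, ((Σ c, Σ i : {i // κ i = c}, E i.1) → ℚ) →ₗ[ℚ] ((Σ i : {i // κ i = c}, E i.1) → ℚ) :=
    fun c => LinearMap.funLeft ℚ ℚ (@Sigma.mk C (fun c' => Σ i : {i // κ i = c'}, E i.1) c) with hp_def
  set q : ∀ (c : C) (i : {i // κ i = c}), ((Σ i : {i // κ i = c}, E i.1) → ℚ) →ₗ[ℚ] (E i.1 → ℚ) :=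
    fun c i => LinearMap.funLeft ℚ ℚ (@Sigma.mk _ (fun i' : {i // κ i = c} => E i'.1) i) with hq_def
  have hpg : ∀ (c) (f : (Σ c, Σ i : {i // κ i = c}, E i.1) → ℚ) (g : G), p c (fun x => f (g • x)) = fun s => p c f (g • s) := fun _ _ _ => rfl
  have hqg : ∀ (c i) (f : (Σ i : {i // κ i = c}, E i.1) → ℚ) (g : G), q c i (fun x => f (g • x)) = fun s => q c i f (g • s) := fun _ _ _ _ => rfl
  have hpqg : ∀ (c i) (f : (Σ c, Σ i : {i // κ i = c}, E i.1) → ℚ) (g : G), (q c i ∘ₗ p c) (fun x => f (g • x)) = fun s => (q c i ∘ₗ p c) f (g • s) :=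
    fun _ _ _ _ => rfl
  set M : Submodule ℚ ((Σ c, Σ i : {i // κ i = c}, E i.1) → ℚ) := antiSpan G (sigmaType Ψ) with hM_def
  set U : Submodule ℚ ((Σ c, Σ i : {i // κ i = c}, E i.1) → ℚ) := ⨅ c, (antiSpan G (Ψ c)).comap (p c) with hU_def
  have hpU : ∀ c, ∀ f ∈ U, p c f ∈ antiSpan G (Ψ c) := fun c f hf => Submodule.mem_comap.1 ((Submodule.mem_iInf _).1 hf c)
  have hpM' : ∀ c, ∀ a ∈ antiSpan G (Ψ c), ∃ m ∈ M, p c m = a := fun c a ha => by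
    rw [← map_funLeft_mk_antiSpan_sigmaType Ψ c] at ha
    obtain ⟨m, hm, rfl⟩ := ha
    exact ⟨m, hm, rfl⟩
  have hpM : ∀ c, ∀ f ∈ M, p c f ∈ antiSpan G (Ψ c) := fun c f hf => by
    rw [← map_funLeft_mk_antiSpan_sigmaType Ψ c]
    exact ⟨f, hf, rfl⟩
  have hqU' : ∀ c i, ∀ a ∈ antiSpan G (Ψ c), q c i a ∈ antiSpan G (Φ i.1) := fun c i a ha => by
    rw [← map_funLeft_mk_antiSpan_sigmaType (fun i : {i // κ i = c} => Φ i.1) i]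
    exact ⟨a, ha, rfl⟩
  have hMU : M ≤ U := fun f hf => (Submodule.mem_iInf _).2 fun c => Submodule.mem_comap.2 (hpM c f hf)
  have hMst : ∀ g : G, ∀ f ∈ M, (fun x => f (g • x)) ∈ M := fun g f hf => comp_smul_mem_antiSpan hf g
  have hUst : ∀ g : G, ∀ f ∈ U, (fun x => f (g • x)) ∈ U := fun g f hf =>
    (Submodule.mem_iInf _).2 fun c => Submodule.mem_comap.2 (by rw [hpg]; exact comp_smul_mem_antiSpan (hpU c f hf) g)
  -- suppose the conclusion fails: then `M < U`
  by_contra hnot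
  have hlt : M < U := by
    refine lt_of_le_of_ne hMU fun hMU' => hnot ?_
    rintro _ ⟨a, ha, rfl⟩
    rw [hMU']
    refine (Submodule.mem_iInf _).2 fun c => Submodule.mem_comap.2 ?_
    by_cases hc : c = c₀
    · subst hc
      have e : p c (slotExt c a) = a := by
        funext s
        simp only [hp_def, LinearMap.funLeft_apply, slotExt_apply_same]
      rw [e]; exact ha
    · have e : p c (slotExt c₀ a) = 0 := by
        funext s
        simp only [hp_def, LinearMap.funLeft_apply, slotExt_apply_of_ne hc, Pi.zero_apply]
      rw [e]; exact Submodule.zero_mem _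
  -- the stable subspace `C' = U ⊓ M^⊥` is non-zero; a minimal stable `P ≤ C'`
  set C' : Submodule ℚ ((Σ c, Σ i : {i // κ i = c}, E i.1) → ℚ) := U ⊓ LinearMap.BilinForm.orthogonal (dotProductBilin ℚ ℚ) M with hC_def
  have hCst : ∀ g : G, ∀ f ∈ C', (fun x => f (g • x)) ∈ C' := fun g f hf => ⟨hUst g f hf.1, PointwiseConj.comp_smul_mem_orthogonal hMst hf.2 g⟩
  have hC0 : C' ≠ ⊥ := by
    intro hC0
    have h1 := Submodule.finrank_sup_add_finrank_inf_eq U (LinearMap.BilinForm.orthogonal (dotProductBilin ℚ ℚ) M)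
    have h2 := LinearMap.BilinForm.finrank_orthogonal (nondegenerate_dotProductBilin_rat (X := Σ c, Σ i : {i // κ i = c}, E i.1)) M
    have h3 := Submodule.finrank_lt_finrank_of_lt hlt
    have h4 := Submodule.finrank_le (U ⊔ LinearMap.BilinForm.orthogonal (dotProductBilin ℚ ℚ) M)
    have h5 := Submodule.finrank_le M
    rw [← hC_def, hC0, finrank_bot] at h1
    omega
  obtain ⟨P, hPC, hP0, hPst, hPmin⟩ := exists_minimal_stable_submodule (G := G) hC0 hCst
  have hPU : P ≤ U := hPC.trans inf_le_left
  have hqpU : ∀ c i, ∀ f ∈ P, (q c i ∘ₗ p c) f ∈ antiSpan G (Φ i.1) := fun c i f hf => hqU' c i _ (hpU c f (hPU hf))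
  -- inner restrictions indexed by the original slots
  let ri : ∀ i : I, ((Σ c, Σ i : {i // κ i = c}, E i.1) → ℚ) →ₗ[ℚ] (E i → ℚ) := fun i => q (κ i) ⟨i, rfl⟩ ∘ₗ p (κ i)
  have hqri : ∀ (c : C) (i : {i // κ i = c}), q c i ∘ₗ p c = ri i.1 := by
    rintro c ⟨i, rfl⟩
    rfl
  have hrig : ∀ (i) (f : (Σ c, Σ i : {i // κ i = c}, E i.1) → ℚ) (g : G), ri i (fun x => f (g • x)) = fun s => ri i f (g • s) := fun _ _ _ => rfl
  have hriU : ∀ i, ∀ f ∈ P, ri i f ∈ antiSpan G (Φ i) := fun i f hf => hqU' (κ i) ⟨i, rfl⟩ _ (hpU (κ i) f (hPU hf))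
  -- zero or injective
  have hdich : ∀ i, (∀ f ∈ P, ri i f = 0) ∨ ∀ f ∈ P, ri i f = 0 → f = 0 :=
    fun i => forall_eq_zero_or_injOn_of_minimal_stable (G := G) hPst hPmin (ri i) (fun g f _ => hrig i f g)
  -- the support
  let J : Finset I := Finset.univ.filter fun i => ¬ ∀ f ∈ P, ri i f = 0
  have hJ : ∀ i, i ∈ J ↔ ¬ ∀ f ∈ P, ri i f = 0 := fun i => by simp only [J, Finset.mem_filter, Finset.mem_univ, true_and]
  have hinj : ∀ i ∈ J, ∀ f ∈ P, ri i f = 0 → f = 0 := fun i hi => (hdich i).resolve_left ((hJ i).1 hi)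
  have hzero : ∀ i, i ∉ J → ∀ f ∈ P, ri i f = 0 := fun i hi => not_not.1 fun h => hi ((hJ i).2 h)
  -- two slots of the support share the constituent `P`
  have hshare : ∀ i ∈ J, ∀ j ∈ J, i ≠ j →
      ¬ ∀ Q : Submodule ℚ (E i → ℚ), Q ≤ antiSpan G (Φ i) → (∀ g : G, ∀ f ∈ Q, (fun x => f (g • x)) ∈ Q) →
        ∀ T : (E i → ℚ) →ₗ[ℚ] (E j → ℚ), (∀ g : G, ∀ f ∈ Q, T (fun x => f (g • x)) = fun y => T f (g • y)) →
          (∀ f ∈ Q, T f ∈ antiSpan G (Φ j)) → (∀ f ∈ Q, T f = 0 → f = 0) → Q = ⊥ := fun i hi j hj _ =>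
    not_pairwise_of_two_injOn (G := G) hP0 hPst (ri i) (ri j) (fun g f _ => hrig i f g) (fun g f _ => hrig j f g) (hinj i hi) (hinj j hj) (hriU i) (hriU j)
  -- a non-zero `f₀ ∈ P`; the support is non-empty
  obtain ⟨f₀, hf₀, hf₀0⟩ := (Submodule.ne_bot_iff P).1 hP0
  have horth : ∀ m ∈ M, m ⬝ᵥ f₀ = 0 := fun m hm => by
    have h2 := LinearMap.BilinForm.mem_orthogonal_iff.1 (hPC hf₀).2 m hm
    simpa only [dotProductBilin, LinearMap.coe_mk, AddHom.coe_mk] using h2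
  have hdot : ∀ m : (Σ c, Σ i : {i // κ i = c}, E i.1) → ℚ, m ⬝ᵥ f₀ = ∑ i, ri i m ⬝ᵥ ri i f₀ := fun m => by
    have h1 : m ⬝ᵥ f₀ = ∑ c, ∑ i : {i // κ i = c}, (q c i ∘ₗ p c) m ⬝ᵥ (q c i ∘ₗ p c) f₀ := by
      simp only [dotProduct, LinearMap.comp_apply, LinearMap.funLeft_apply, hq_def, hp_def]
      rw [Fintype.sum_sigma]
      exact Finset.sum_congr rfl fun c _ => Fintype.sum_sigma _
    rw [h1]
    have h2 : ∀ c, ∑ i : {i // κ i = c}, (q c i ∘ₗ p c) m ⬝ᵥ (q c i ∘ₗ p c) f₀ = ∑ i : {i // κ i = c}, ri i.1 m ⬝ᵥ ri i.1 f₀ :=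
      fun c => Finset.sum_congr rfl fun i _ => by rw [hqri c i]
    simp_rw [h2]
    exact Fintype.sum_fiberwise κ fun i => ri i m ⬝ᵥ ri i f₀
  have hex : ∃ i, i ∈ J := by
    by_contra hall
    push Not at hall
    apply hf₀0
    funext x
    obtain ⟨c, ⟨i, rfl⟩, s⟩ := x
    exact congrFun (hzero i (hall i) f₀ hf₀) s
  obtain ⟨i₁, hi₁⟩ := hex
  by_cases htwo : ∃ i ∈ J, ∃ j ∈ J, κ i ≠ κ j
  · -- the support meets two blocks: it is jointly onto
    obtain ⟨m, hm, hmJ⟩ := hyp J htwo hshare (fun i => ri i f₀) fun i _ => hriU i f₀ hf₀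
    set m' : (Σ c, Σ i : {i // κ i = c}, E i.1) → ℚ := LinearMap.funLeft ℚ ℚ (fun x : (Σ c, Σ i : {i // κ i = c}, E i.1) => (⟨x.2.1.1, x.2.2⟩ : Σ i, E i)) m
      with hm'_def
    have hm'M : m' ∈ M := by
      rw [hM_def, hΨ_def, ← map_funLeft_regroup_antiSpan_sigmaType Φ κ]
      exact ⟨m, hm, rfl⟩
    have hm'r : ∀ i, ri i m' = LinearMap.funLeft ℚ ℚ (Sigma.mk i) m := fun i => rfl
    have hterm : ∀ i, ri i m' ⬝ᵥ ri i f₀ = ri i f₀ ⬝ᵥ ri i f₀ := fun i => by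
      by_cases hi : i ∈ J
      · rw [hm'r, hmJ i hi]
      · rw [hzero i hi f₀ hf₀, dotProduct_zero, dotProduct_zero]
    have h0 := horth m' hm'M
    rw [hdot] at h0
    simp_rw [hterm] at h0
    have hnn : ∀ i, 0 ≤ ri i f₀ ⬝ᵥ ri i f₀ := fun i => Finset.sum_nonneg fun x _ => mul_self_nonneg _
    have hle : ri i₁ f₀ ⬝ᵥ ri i₁ f₀ ≤ ∑ i, ri i f₀ ⬝ᵥ ri i f₀ := Finset.single_le_sum (fun i _ => hnn i) (Finset.mem_univ i₁)
    rw [h0] at hle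
    have hz : ri i₁ f₀ ⬝ᵥ ri i₁ f₀ = 0 := le_antisymm hle (hnn i₁)
    exact hf₀0 (hinj i₁ hi₁ f₀ hf₀ (dotProduct_self_eq_zero.1 hz))
  · -- the support lies in the block `c₁ = κ i₁`: `f₀` is supported on the outer slot `c₁` (p2's case)
    push Not at htwo
    have hvan : ∀ c, c ≠ κ i₁ → p c f₀ = 0 := fun c hc => by
      funext x
      obtain ⟨⟨i, rfl⟩, s⟩ := x
      have hi : κ i ≠ κ i₁ := hc
      have hiJ : i ∉ J := fun h => hi (htwo i h i₁ hi₁)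
      exact congrFun (hzero i hiJ f₀ hf₀) s
    obtain ⟨m, hmM, hm⟩ := hpM' (κ i₁) (p (κ i₁) f₀) (hpU (κ i₁) f₀ (hPU hf₀))
    have h0 := horth m hmM
    have hsum : m ⬝ᵥ f₀ = p (κ i₁) f₀ ⬝ᵥ p (κ i₁) f₀ := by
      have hdot' : ∀ m' : (Σ c, Σ i : {i // κ i = c}, E i.1) → ℚ, m' ⬝ᵥ f₀ = ∑ c, p c m' ⬝ᵥ p c f₀ := fun m' => by
        simp only [dotProduct, LinearMap.funLeft_apply, hp_def]
        rw [Fintype.sum_sigma]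
      rw [hdot', Finset.sum_eq_single (κ i₁)]
      · rw [hm]
      · intro c _ hc; rw [hvan c hc, dotProduct_zero]
      · intro h; exact absurd (Finset.mem_univ _) h
    rw [hsum] at h0
    have hp0 : p (κ i₁) f₀ = 0 := dotProduct_self_eq_zero.1 h0
    apply hf₀0
    funext x
    obtain ⟨c, i, s⟩ := x
    by_cases hc : c = κ i₁
    · subst hc; exact congrFun hp0 ⟨i, s⟩
    · exact congrFun (hvan c hc) ⟨i, s⟩

/-- **`dim U(⊔_c Σ|_c) = Σ_c dim U(Σ|_c)`** under the jointly-onto-sets hypothesis. [cite: Gordon1999HodgeAVSurvey, §3 Theorem (1)] [cite: MoonenZarhin1999LowDim, §3 (3.1)] -/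
theorem finrank_antiSpan_sigmaType_fiber_eq_of_jointlyOnto_sets {Φ : ∀ i, Set (E i)} (κ : I → C)
    (hyp : ∀ J : Finset I, (∃ i ∈ J, ∃ j ∈ J, κ i ≠ κ j) →
      (∀ i ∈ J, ∀ j ∈ J, i ≠ j → ¬ (∀ P : Submodule ℚ (E i → ℚ), P ≤ antiSpan G (Φ i) → (∀ g : G, ∀ f ∈ P, (fun x => f (g • x)) ∈ P) →
          ∀ T : (E i → ℚ) →ₗ[ℚ] (E j → ℚ), (∀ g : G, ∀ f ∈ P, T (fun x => f (g • x)) = fun y => T f (g • y)) →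
            (∀ f ∈ P, T f ∈ antiSpan G (Φ j)) → (∀ f ∈ P, T f = 0 → f = 0) → P = ⊥)) →
      ∀ a : ∀ i, E i → ℚ, (∀ i ∈ J, a i ∈ antiSpan G (Φ i)) →
        ∃ m ∈ antiSpan G (sigmaType Φ), ∀ i ∈ J, LinearMap.funLeft ℚ ℚ (Sigma.mk i) m = a i) :
    Module.finrank ℚ (antiSpan G (sigmaType fun c => sigmaType fun i : {i // κ i = c} => Φ i.1)) =
      ∑ c, Module.finrank ℚ (antiSpan G (sigmaType fun i : {i // κ i = c} => Φ i.1)) := by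
  classical
  set Ψ : ∀ c : C, Set (Σ i : {i // κ i = c}, E i.1) := fun c => sigmaType fun i : {i // κ i = c} => Φ i.1 with hΨ_def
  refine le_antisymm (finrank_antiSpan_sigmaType_le Ψ) ?_
  have hrange : LinearMap.range (sigmaLift ∘ₗ LinearMap.pi fun c => (antiSpan G (Ψ c)).subtype ∘ₗ LinearMap.proj c) ≤ antiSpan G (sigmaType Ψ) := by
    rintro _ ⟨a, rfl⟩
    change sigmaLift (fun c => (a c : (Σ i : {i // κ i = c}, E i.1) → ℚ)) ∈ _
    rw [sigmaLift_eq_sum_slotExt]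
    exact Submodule.sum_mem _ fun c _ =>
      map_slotExt_antiSpan_fiber_le_of_jointlyOnto_sets κ hyp c ⟨(a c : (Σ i : {i // κ i = c}, E i.1) → ℚ), (a c).2, rfl⟩
  have hinj : Function.Injective (sigmaLift ∘ₗ LinearMap.pi fun c => (antiSpan G (Ψ c)).subtype ∘ₗ LinearMap.proj c) := by
    intro a b hab
    funext c
    apply Subtype.ext
    funext s
    exact congrFun hab ⟨c, s⟩
  calc ∑ c, Module.finrank ℚ (antiSpan G (Ψ c))
      = Module.finrank ℚ (∀ c, antiSpan G (Ψ c)) := (Module.finrank_pi_fintype ℚ).symm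
    _ = Module.finrank ℚ (LinearMap.range (sigmaLift ∘ₗ LinearMap.pi fun c => (antiSpan G (Ψ c)).subtype ∘ₗ LinearMap.proj c)) :=
        (LinearMap.finrank_range_of_inj hinj).symm
    _ ≤ Module.finrank ℚ (antiSpan G (sigmaType Ψ)) := Submodule.finrank_mono hrange

variable [Nonempty I] [∀ i, Nonempty (E i)]

/-- **BLOCK ADDITIVITY WITH JOINTLY-ONTO EXCEPTIONAL SETS: `rank(Σ) + |C| = Σ_c rank(Σ|_c) + 1`** (`Hg(∏_i A_i) = ∏_c Hg(∏_{κ i = c} A_i)`) for a surjection `κ : I → C`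
such that every finite set of slots meeting two blocks and pairwise sharing constituents is jointly onto in `U(Σ)`.  Contains the slot criterion and the pair version.
[cite: Gordon1999HodgeAVSurvey, §3 Theorem (1) (proof)] [cite: MoonenZarhin1999LowDim, §3 (3.1), Remark (3.9)] -/
theorem typeRank_sigmaType_add_card_eq_of_jointlyOnto_sets_fiber {ρ : G} {Φ : ∀ i, Set (E i)} (h : ∀ i, IsCMTypeWith ρ (Φ i))
    (κ : I → C) (hκ : Function.Surjective κ)
    (hyp : ∀ J : Finset I, (∃ i ∈ J, ∃ j ∈ J, κ i ≠ κ j) →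
      (∀ i ∈ J, ∀ j ∈ J, i ≠ j → ¬ (∀ P : Submodule ℚ (E i → ℚ), P ≤ antiSpan G (Φ i) → (∀ g : G, ∀ f ∈ P, (fun x => f (g • x)) ∈ P) →
          ∀ T : (E i → ℚ) →ₗ[ℚ] (E j → ℚ), (∀ g : G, ∀ f ∈ P, T (fun x => f (g • x)) = fun y => T f (g • y)) →
            (∀ f ∈ P, T f ∈ antiSpan G (Φ j)) → (∀ f ∈ P, T f = 0 → f = 0) → P = ⊥)) →
      ∀ a : ∀ i, E i → ℚ, (∀ i ∈ J, a i ∈ antiSpan G (Φ i)) →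
        ∃ m ∈ antiSpan G (sigmaType Φ), ∀ i ∈ J, LinearMap.funLeft ℚ ℚ (Sigma.mk i) m = a i) :
    typeRank G (sigmaType Φ) + Fintype.card C = (∑ c, typeRank G (sigmaType fun i : {i // κ i = c} => Φ i.1)) + 1 := by
  classical
  haveI : Nonempty C := ⟨κ (Classical.arbitrary I)⟩
  haveI hne : ∀ c, Nonempty (Σ i : {i // κ i = c}, E i.1) := fun c => by
    obtain ⟨i, hi⟩ := hκ c
    exact ⟨⟨⟨i, hi⟩, Classical.arbitrary (E i)⟩⟩
  have hΨ : ∀ c, IsCMTypeWith ρ (sigmaType fun i : {i // κ i = c} => Φ i.1) := fun c => isCMTypeWith_sigmaType_fiber h κ c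
  haveI : Nonempty (Σ c, Σ i : {i // κ i = c}, E i.1) := ⟨⟨Classical.arbitrary C, Classical.arbitrary _⟩⟩
  rw [← typeRank_sigmaType_fiber Φ κ, (IsCMTypeWith.sigmaType hΨ).typeRank_eq_finrank_antiSpan_add_one,
    Finset.sum_congr rfl fun c _ => (hΨ c).typeRank_eq_finrank_antiSpan_add_one, Finset.sum_add_distrib, Finset.sum_const, Finset.card_univ,
    smul_eq_mul, mul_one, finrank_antiSpan_sigmaType_fiber_eq_of_jointlyOnto_sets κ hyp]
  omega

end Core

end Literature.NumberTheory.ComplexMultiplication.MultiFieldWeil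

end
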